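import Summits.ValiantsHypothesis.ValiantsHypothesis.Theorems.LacunarySymmetroidMatrixDescartesDoorA26WallBubblingBubblingInertiaClosed

/-!
# `DoorA26` line `wall_bubbling` — shared SECOND-ORDER engine: the rank-3 Schur identity on the complement block and the second-order limit

HONEST FRAMING.  Object-search cell `pub-symmetroid`; crux `Theses.LacunarySymmetroid.DoorA26` (stmt-ValiantsHypothesis-19979;
OPEN, typed, never asserted).  Line `Cruxes/DoorA26/Lines/wall_bubbling.lean` (val-idea-15): obligations (W) `stub_weylFaces` and
(M) `stub_mixedWalls` need the SECOND-ORDER sieve — the first-order blow-up patterns at Weyl faces / mixed walls are realisable, so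
one must use that a realisable would-be Gram matrix `G` (polar Gram of six symmetric `2 × 2` letters, `(Sym₂ℝ, det) ≅ ℝ^{1,2}`) has
RANK ≤ 3: once a `3 × 3` principal block `G_II` is invertible, EVERY other entry is determined, `G_{jj'} = G_{jI} G_II⁻¹ G_{Ij'}`.
This file is the shared, definition-free engine the (W)/(M) seats import (director R260 / desk R2664, slot W3):

* `det_border_of_shape` — every `4 × 4` block (principal or not, here indexed by `Fin 3 ⊕ Unit`) of a rank-3 shape
  `ε · (v vᵀ − u uᵀ − w wᵀ)` has determinant zero (padding by a zero column; any index type);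
* `schur_of_shape`, `schur_of_isSymGram`, `schur_of_realisable` — the RANK-3 SCHUR IDENTITY in entry form
  `M j j' = (a ↦ M j (I a)) ⬝ᵥ (M_II⁻¹ *ᵥ (b ↦ M (I b) j'))` whenever `det M_II ≠ 0` (Mathlib's `det_fromBlocks₁₁` on the bordered
  block + the vanishing above); `Realisable` through the chain's `realisable_iff` (`ε = ±1`);
* `secondOrder_limit` — the SECOND-ORDER LIMIT: along a sequence of realisable `G^ν` with a normalised invertible block limit
  `B_ν⁻¹ G^ν_II → P` (`det P ≠ 0`) and normalised cross limits `ρ_ν⁻¹ G^ν_{jI} → ω`, `ρ'_ν⁻¹ G^ν_{Ij'} → ω'`, the complement entry obeys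
  `B_ν/(ρ_ν ρ'_ν) · G^ν_{jj'} → ω ⬝ᵥ P⁻¹ ω'`; `secondOrder_pos`/`secondOrder_neg` give the eventual sign.  (W1's mixed-wall parity limit is the
  instance `P = Eᵢᵢ − ½(Eₖₗ + Eₗₖ)`, `j = j'`.)
* `mixedWall_firstOrder_pattern` — at an exponent vector whose only pair-sum coincidence is `(i,i) ~ (k,l)`, `BlockSumsZero` forces the
  first-order pattern `G = Gᵢᵢ · (Eᵢᵢ − ½(Eₖₗ + Eₗₖ))` (so the natural block normalisation is `B_ν := G^ν ᵢᵢ`).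

Realisability / inertia CLOSURE is already kernel in the chain (`isClosed_realisable`, `realisable_of_tendsto`,
`…WallBubblingBubblingInertiaClosed`) and is only re-cited here.  NOT here: the second-level cluster normalisation (the anatomy
theorem producing `hblock` and the `ρ`-limits from an accumulation of twenties) and the confluent Weyl slot — successor pieces.
Nothing in this file bears on the line's (R), on `DoorA26`, on `MatrixDescartes` (18050) or on `VP ≠ VNP`.

[folklore] Elementary linear algebra (rank-3 Schur complement) and a routine limit.
-/

-- `Summit.ValiantsHypothesis.ValiantsHypothesis.…` repeats a component by the D-0017 layout
-- (single-conjunct summit), which the `dupNamespace` linter flags; the name is mandated.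
set_option linter.dupNamespace false

namespace Summit.ValiantsHypothesis.ValiantsHypothesis.Theorems.LacunarySymmetroidMatrixDescartes.WallBubbling.SecondOrder

open Matrix Filter Topology Finset
open scoped BigOperators
open Summit.ValiantsHypothesis.ValiantsHypothesis.Theorems.LacunarySymmetroidMatrixDescartes.WallBubbling.Bubbling

section Shape

variable {n : Type*}

/-- **Every `4 × 4` block of a rank-3 shape vanishes.**  For `v u w : n → ℝ`, a scalar `ε` and ANY row/column selections
`r c : Fin 3 ⊕ Unit → n` (repetitions allowed, principal or not), the `4 × 4` matrix
`(a,b) ↦ ε (v_{r a} v_{c b} − u_{r a} u_{c b} − w_{r a} w_{c b})` is singular: it factors through `ℝ³`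
(written as a product of two `4 × 4` matrices, the first with a zero column). [folklore] -/
theorem det_border_of_shape (ε : ℝ) (v u w : n → ℝ) (r c : Fin 3 ⊕ Unit → n) :
    (Matrix.of fun a b : Fin 3 ⊕ Unit => ε * (v (r a) * v (c b) - u (r a) * u (c b) - w (r a) * w (c b))).det = 0 := by
  let f : Fin 3 → n → ℝ := ![v, u, w]
  let d : Fin 3 → ℝ := ![1, -1, -1]
  let P : Matrix (Fin 3 ⊕ Unit) (Fin 3 ⊕ Unit) ℝ :=
    Matrix.of fun a s => Sum.elim (fun s : Fin 3 => ε * d s * f s (r a)) (fun _ => (0 : ℝ)) s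
  let Q : Matrix (Fin 3 ⊕ Unit) (Fin 3 ⊕ Unit) ℝ :=
    Matrix.of fun s b => Sum.elim (fun s : Fin 3 => f s (c b)) (fun _ => (0 : ℝ)) s
  have hPQ : (Matrix.of fun a b : Fin 3 ⊕ Unit =>
      ε * (v (r a) * v (c b) - u (r a) * u (c b) - w (r a) * w (c b))) = P * Q := by
    ext a b
    simp only [P, Q, f, d, Matrix.mul_apply, Matrix.of_apply, Fintype.sum_sum_type, Sum.elim_inl, Sum.elim_inr,
      Fin.sum_univ_three, Finset.univ_unique, Finset.sum_singleton, mul_zero, add_zero,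
      Matrix.cons_val_zero, Matrix.cons_val_one, Matrix.cons_val_two, Matrix.head_cons, Matrix.tail_cons]
    ring
  have hP : P.det = 0 :=
    Matrix.det_eq_zero_of_column_eq_zero (Sum.inr ()) (fun a => by simp [P])
  rw [hPQ, Matrix.det_mul, hP, zero_mul]

/-- **RANK-3 SCHUR IDENTITY ON THE COMPLEMENT BLOCK (shape form).**  If `M = ε · (v vᵀ − u uᵀ − w wᵀ)` and the principal
`3 × 3` block on `I : Fin 3 → n` has non-zero determinant, then every entry is read off that block:
`M j j' = (a ↦ M j (I a)) ⬝ᵥ (M_II⁻¹ *ᵥ (b ↦ M (I b) j'))` — i.e. `G_JJ = G_JI G_II⁻¹ G_IJ` entrywise.  Proof: the bordered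
`4 × 4` block `[[M_II, M_Ij'],[M_jI, M_jj']]` is singular (`det_border_of_shape`) and `det_fromBlocks₁₁` factors its determinant as
`det M_II · (M_jj' − M_jI M_II⁻¹ M_Ij')`. [folklore] -/
theorem schur_of_shape (ε : ℝ) (v u w : n → ℝ) (M : Matrix n n ℝ)
    (hM : M = ε • (vecMulVec v v - vecMulVec u u - vecMulVec w w))
    (I : Fin 3 → n) (hI : IsUnit (M.submatrix I I).det) (j j' : n) :
    M j j' = (fun a => M j (I a)) ⬝ᵥ ((M.submatrix I I)⁻¹ *ᵥ fun b => M (I b) j') := by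
  have hentry : ∀ x y, M x y = ε * (v x * v y - u x * u y - w x * w y) := by
    intro x y; rw [hM]; simp [Matrix.sub_apply, Matrix.vecMulVec_apply]
  set X : Matrix (Fin 3) (Fin 3) ℝ := M.submatrix I I with hX
  haveI : Invertible X := Matrix.invertibleOfIsUnitDet X hI
  let Bc : Matrix (Fin 3) Unit ℝ := Matrix.of fun b _ => M (I b) j'
  let Cr : Matrix Unit (Fin 3) ℝ := Matrix.of fun _ a => M j (I a)
  let D : Matrix Unit Unit ℝ := Matrix.of fun _ _ => M j j'
  -- the bordered block is a `4 × 4` block of the shape, hence singular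
  have hblock : Matrix.fromBlocks X Bc Cr D =
      Matrix.of fun a b : Fin 3 ⊕ Unit => ε * (v (Sum.elim I (fun _ => j) a) * v (Sum.elim I (fun _ => j') b)
        - u (Sum.elim I (fun _ => j) a) * u (Sum.elim I (fun _ => j') b)
        - w (Sum.elim I (fun _ => j) a) * w (Sum.elim I (fun _ => j') b)) := by
    ext a b
    rcases a with a | ⟨⟩ <;> rcases b with b | ⟨⟩
    · simp [hX, hentry]
    · simp [Bc, hentry]
    · simp [Cr, hentry]
    · simp [D, hentry]
  have hdet0 : (Matrix.fromBlocks X Bc Cr D).det = 0 := by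
    rw [hblock]; exact det_border_of_shape ε v u w _ _
  rw [Matrix.det_fromBlocks₁₁] at hdet0
  rw [Matrix.det_unique (D - Cr * ⅟X * Bc)] at hdet0
  have hXdet : X.det ≠ 0 := hI.ne_zero
  have h2 : (D - Cr * ⅟X * Bc) default default = 0 := by
    rcases mul_eq_zero.mp hdet0 with h | h
    · exact absurd h hXdet
    · exact h
  rw [Matrix.invOf_eq_nonsing_inv] at h2
  have h3 : (Cr * X⁻¹ * Bc) default default = (fun a => M j (I a)) ⬝ᵥ (X⁻¹ *ᵥ fun b => M (I b) j') := by
    simp only [Matrix.mul_apply, Cr, Bc, Matrix.of_apply, dotProduct, Matrix.mulVec, Finset.sum_mul]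
    rw [Finset.sum_comm]
    refine Finset.sum_congr rfl fun a _ => ?_
    rw [Finset.mul_sum]
    refine Finset.sum_congr rfl fun b _ => ?_
    ring
  have h4 : (D - Cr * X⁻¹ * Bc) default default = M j j' - (Cr * X⁻¹ * Bc) default default := by
    simp [D]
  rw [h4, h3] at h2
  linarith

/-- The identity for the chain's `IsSymGram` shape (`ε = 1`). [folklore] -/
theorem schur_of_isSymGram [Fintype n] {M : Matrix n n ℝ} (hM : IsSymGram M)
    (I : Fin 3 → n) (hI : IsUnit (M.submatrix I I).det) (j j' : n) :
    M j j' = (fun a => M j (I a)) ⬝ᵥ ((M.submatrix I I)⁻¹ *ᵥ fun b => M (I b) j') := by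
  obtain ⟨v, u, w, h⟩ := hM
  exact schur_of_shape 1 v u w M (by rw [h, one_smul]) I hI j j'

end Shape

/-- **RANK-3 SCHUR IDENTITY for realisable would-be Gram matrices** (the line's `Realisable`, single copy of the chain): if the
polar Gram matrix `G` of six symmetric `2 × 2` letters (up to the global sign) has an invertible principal `3 × 3` block on `I`, then
`G j j' = (a ↦ G j (I a)) ⬝ᵥ (G_II⁻¹ *ᵥ (b ↦ G (I b) j'))` for all `j, j'`.  Via `realisable_iff` (`G` or `−G` is a rank-3 shape). [folklore] -/
theorem schur_of_realisable {G : Matrix (Fin 6) (Fin 6) ℝ} (hG : Realisable G)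
    (I : Fin 3 → Fin 6) (hI : IsUnit (G.submatrix I I).det) (j j' : Fin 6) :
    G j j' = (fun a => G j (I a)) ⬝ᵥ ((G.submatrix I I)⁻¹ *ᵥ fun b => G (I b) j') := by
  rcases (realisable_iff G).mp hG with h | h
  · exact schur_of_isSymGram h I hI j j'
  · obtain ⟨v, u, w, hneg⟩ := h
    have hM : G = (-1 : ℝ) • (vecMulVec v v - vecMulVec u u - vecMulVec w w) := by
      rw [← hneg, neg_one_smul, neg_neg]
    exact schur_of_shape (-1) v u w G hM I hI j j'

/-! ## The second-order limit -/

/-- Inverse of a non-zero scalar multiple of an invertible matrix. [folklore] -/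
theorem inv_smul_of_isUnit {m : Type*} [Fintype m] [DecidableEq m] (c : ℝ) (hc : c ≠ 0)
    (X : Matrix m m ℝ) (hX : IsUnit X.det) : (c • X)⁻¹ = c⁻¹ • X⁻¹ := by
  refine Matrix.inv_eq_left_inv ?_
  rw [smul_mul_smul_comm, inv_mul_cancel₀ hc, one_smul, Matrix.nonsing_inv_mul _ hX]

/-- `x ⬝ᵥ (A *ᵥ y)` as a double sum. [folklore] -/
theorem dot_mulVec_eq_sum {m : Type*} [Fintype m] (x : m → ℝ) (A : Matrix m m ℝ) (y : m → ℝ) :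
    x ⬝ᵥ (A *ᵥ y) = ∑ a, ∑ b, x a * A a b * y b := by
  simp only [dotProduct, Matrix.mulVec, Finset.mul_sum, mul_assoc]

/-- **SECOND-ORDER LIMIT.**  Along a sequence of realisable would-be Gram matrices `G^ν` suppose a principal `3 × 3` block,
normalised by scalars `B_ν ≠ 0`, converges to an INVERTIBLE pattern `P` (`B_ν⁻¹ G^ν_II → P`, `det P ≠ 0`) and the cross entries,
normalised by `ρ_ν, ρ'_ν ≠ 0`, converge (`ρ_ν⁻¹ G^ν_{j,I} → ω`, `ρ'_ν⁻¹ G^ν_{I,j'} → ω'`).  Then the complement entry is SECOND ORDER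
and its normalised limit is forced by the rank-3 Schur identity: `B_ν/(ρ_ν ρ'_ν) · G^ν_{jj'} → ω ⬝ᵥ (P⁻¹ ω')`. [folklore] -/
theorem secondOrder_limit (G : ℕ → Matrix (Fin 6) (Fin 6) ℝ) (hG : ∀ ν, Realisable (G ν))
    (I : Fin 3 → Fin 6) (j j' : Fin 6) (B ρ ρ' : ℕ → ℝ) (hB : ∀ ν, B ν ≠ 0) (hρ : ∀ ν, ρ ν ≠ 0) (hρ' : ∀ ν, ρ' ν ≠ 0)
    (P : Matrix (Fin 3) (Fin 3) ℝ) (hP : IsUnit P.det)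
    (hblock : Tendsto (fun ν => (B ν)⁻¹ • (G ν).submatrix I I) atTop (𝓝 P))
    (ω ω' : Fin 3 → ℝ) (hω : Tendsto (fun ν => fun a => (ρ ν)⁻¹ * G ν j (I a)) atTop (𝓝 ω))
    (hω' : Tendsto (fun ν => fun b => (ρ' ν)⁻¹ * G ν (I b) j') atTop (𝓝 ω')) :
    Tendsto (fun ν => B ν / (ρ ν * ρ' ν) * G ν j j') atTop (𝓝 (ω ⬝ᵥ (P⁻¹ *ᵥ ω'))) := by
  -- eventually the normalised block is invertible
  have hdet : Tendsto (fun ν => ((B ν)⁻¹ • (G ν).submatrix I I).det) atTop (𝓝 P.det) :=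
    (continuous_id.matrix_det.tendsto P).comp hblock
  have hne : ∀ᶠ ν in atTop, ((B ν)⁻¹ • (G ν).submatrix I I).det ≠ 0 := hdet.eventually_ne hP.ne_zero
  -- the inverse is continuous at `P`
  have hinvP : ContinuousAt Inv.inv P := by
    refine continuousAt_matrix_inv P ?_
    obtain ⟨uP, huP⟩ := hP
    rw [← huP]
    exact NormedRing.inverse_continuousAt uP
  have hinv : Tendsto (fun ν => ((B ν)⁻¹ • (G ν).submatrix I I)⁻¹) atTop (𝓝 P⁻¹) := hinvP.tendsto.comp hblock
  -- entrywise limits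
  have hinv_ab : ∀ a b : Fin 3, Tendsto (fun ν => ((B ν)⁻¹ • (G ν).submatrix I I)⁻¹ a b) atTop (𝓝 (P⁻¹ a b)) :=
    fun a b => ((continuous_id.matrix_elem a b).tendsto P⁻¹).comp hinv
  have hω_a : ∀ a : Fin 3, Tendsto (fun ν => (ρ ν)⁻¹ * G ν j (I a)) atTop (𝓝 (ω a)) :=
    fun a => (continuous_apply a).continuousAt.tendsto.comp hω
  have hω_b : ∀ b : Fin 3, Tendsto (fun ν => (ρ' ν)⁻¹ * G ν (I b) j') atTop (𝓝 (ω' b)) :=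
    fun b => (continuous_apply b).continuousAt.tendsto.comp hω'
  have hlim : Tendsto (fun ν => ∑ a, ∑ b, (ρ ν)⁻¹ * G ν j (I a) * ((B ν)⁻¹ • (G ν).submatrix I I)⁻¹ a b *
      ((ρ' ν)⁻¹ * G ν (I b) j')) atTop (𝓝 (∑ a, ∑ b, ω a * P⁻¹ a b * ω' b)) :=
    tendsto_finsetSum _ fun a _ => tendsto_finsetSum _ fun b _ => ((hω_a a).mul (hinv_ab a b)).mul (hω_b b)
  rw [dot_mulVec_eq_sum]
  refine hlim.congr' ?_
  filter_upwards [hne] with ν hν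
  have hXu : IsUnit ((B ν)⁻¹ • (G ν).submatrix I I).det := isUnit_iff_ne_zero.mpr hν
  have hGIIu : IsUnit ((G ν).submatrix I I).det := by
    have e : ((B ν)⁻¹ • (G ν).submatrix I I).det = (B ν)⁻¹ ^ 3 * ((G ν).submatrix I I).det := by
      rw [Matrix.det_smul, Fintype.card_fin]
    rw [e] at hν
    exact isUnit_iff_ne_zero.mpr (right_ne_zero_of_mul hν)
  have hs := schur_of_realisable (hG ν) I hGIIu j j'
  have hGII : (G ν).submatrix I I = B ν • ((B ν)⁻¹ • (G ν).submatrix I I) := by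
    rw [smul_smul, mul_inv_cancel₀ (hB ν), one_smul]
  have hinvG : ((G ν).submatrix I I)⁻¹ = (B ν)⁻¹ • ((B ν)⁻¹ • (G ν).submatrix I I)⁻¹ := by
    conv_lhs => rw [hGII]
    exact inv_smul_of_isUnit (B ν) (hB ν) _ hXu
  rw [hinvG, dot_mulVec_eq_sum] at hs
  rw [hs, Finset.mul_sum]
  refine Finset.sum_congr rfl fun a _ => ?_
  rw [Finset.mul_sum]
  refine Finset.sum_congr rfl fun b _ => ?_
  rw [Matrix.smul_apply, smul_eq_mul]
  have hB' := hB ν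
  have hρ1 := hρ ν
  have hρ2 := hρ' ν
  field_simp

/-- Eventual sign, positive case: if the second-order value `ω ⬝ᵥ P⁻¹ ω'` is positive then so is `B_ν/(ρ_ν ρ'_ν) · G^ν_{jj'}`
for all large `ν`. [folklore] -/
theorem secondOrder_pos (G : ℕ → Matrix (Fin 6) (Fin 6) ℝ) (hG : ∀ ν, Realisable (G ν))
    (I : Fin 3 → Fin 6) (j j' : Fin 6) (B ρ ρ' : ℕ → ℝ) (hB : ∀ ν, B ν ≠ 0) (hρ : ∀ ν, ρ ν ≠ 0) (hρ' : ∀ ν, ρ' ν ≠ 0)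
    (P : Matrix (Fin 3) (Fin 3) ℝ) (hP : IsUnit P.det)
    (hblock : Tendsto (fun ν => (B ν)⁻¹ • (G ν).submatrix I I) atTop (𝓝 P))
    (ω ω' : Fin 3 → ℝ) (hω : Tendsto (fun ν => fun a => (ρ ν)⁻¹ * G ν j (I a)) atTop (𝓝 ω))
    (hω' : Tendsto (fun ν => fun b => (ρ' ν)⁻¹ * G ν (I b) j') atTop (𝓝 ω'))
    (hpos : 0 < ω ⬝ᵥ (P⁻¹ *ᵥ ω')) :
    ∀ᶠ ν in atTop, 0 < B ν / (ρ ν * ρ' ν) * G ν j j' :=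
  (secondOrder_limit G hG I j j' B ρ ρ' hB hρ hρ' P hP hblock ω ω' hω hω').eventually (eventually_gt_nhds hpos)

/-- Eventual sign, negative case. [folklore] -/
theorem secondOrder_neg (G : ℕ → Matrix (Fin 6) (Fin 6) ℝ) (hG : ∀ ν, Realisable (G ν))
    (I : Fin 3 → Fin 6) (j j' : Fin 6) (B ρ ρ' : ℕ → ℝ) (hB : ∀ ν, B ν ≠ 0) (hρ : ∀ ν, ρ ν ≠ 0) (hρ' : ∀ ν, ρ' ν ≠ 0)
    (P : Matrix (Fin 3) (Fin 3) ℝ) (hP : IsUnit P.det)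
    (hblock : Tendsto (fun ν => (B ν)⁻¹ • (G ν).submatrix I I) atTop (𝓝 P))
    (ω ω' : Fin 3 → ℝ) (hω : Tendsto (fun ν => fun a => (ρ ν)⁻¹ * G ν j (I a)) atTop (𝓝 ω))
    (hω' : Tendsto (fun ν => fun b => (ρ' ν)⁻¹ * G ν (I b) j') atTop (𝓝 ω'))
    (hneg : ω ⬝ᵥ (P⁻¹ *ᵥ ω') < 0) :
    ∀ᶠ ν in atTop, B ν / (ρ ν * ρ' ν) * G ν j j' < 0 :=
  (secondOrder_limit G hG I j j' B ρ ρ' hB hρ hρ' P hP hblock ω ω' hω hω').eventually (eventually_lt_nhds hneg)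

/-! ## The first-order pattern at a generic mixed wall -/

/-- **First-order pattern at a generic mixed wall.**  Let `δ : Fin 6 → ℝ` and distinct letters `i, k, l` with
`2 δᵢ = δₖ + δₗ`, and suppose this is the ONLY pair-sum coincidence: whenever `δ a + δ b = δ a' + δ b'` the unordered pairs
`{a,b}`, `{a',b'}` are equal or both lie in `{{i,i},{k,l}}`.  If `G` is symmetric and all pair-sum value classes of `G` sum to zero
(`BlockSumsZero δ G`), then `G` is `Gᵢᵢ` times the pattern `Eᵢᵢ − ½(Eₖₗ + Eₗₖ)`: all entries vanish except
`G i i` and `G k l = G l k = −G i i / 2`. [this work] -/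
theorem mixedWall_firstOrder_pattern (δ : Fin 6 → ℝ) (i k l : Fin 6) (hik : i ≠ k) (hil : i ≠ l) (hkl : k ≠ l)
    (hwall : 2 * δ i = δ k + δ l)
    (honly : ∀ a b a' b' : Fin 6, δ a + δ b = δ a' + δ b' →
      ((a = a' ∧ b = b') ∨ (a = b' ∧ b = a')) ∨
      (((a = i ∧ b = i) ∨ (a = k ∧ b = l) ∨ (a = l ∧ b = k)) ∧
       ((a' = i ∧ b' = i) ∨ (a' = k ∧ b' = l) ∨ (a' = l ∧ b' = k))))
    (G : Matrix (Fin 6) (Fin 6) ℝ) (hGs : G.IsSymm) (hB : BlockSumsZero δ G) :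
    (∀ a b : Fin 6, ¬ ((a = i ∧ b = i) ∨ (a = k ∧ b = l) ∨ (a = l ∧ b = k)) → G a b = 0) ∧
      G k l = - G i i / 2 ∧ G l k = - G i i / 2 := by
  have hsym : ∀ a b, G b a = G a b := fun a b => by
    simpa [Matrix.transpose_apply] using congrFun (congrFun hGs a) b
  -- the value class of a pair `(a,b)` outside the special class is `{(a,b),(b,a)}`
  have hclass : ∀ a b : Fin 6, ¬ ((a = i ∧ b = i) ∨ (a = k ∧ b = l) ∨ (a = l ∧ b = k)) →
      (∑ x, ∑ y, if δ x + δ y = δ a + δ b then G x y else 0) = (if a = b then G a b else G a b + G b a) := by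
    intro a b hab
    have key : ∀ x y, (δ x + δ y = δ a + δ b) ↔ ((x = a ∧ y = b) ∨ (x = b ∧ y = a)) := by
      intro x y
      constructor
      · intro h
        rcases honly x y a b h with h1 | ⟨_, h2⟩
        · exact h1
        · exact absurd h2 hab
      · rintro (⟨rfl, rfl⟩ | ⟨rfl, rfl⟩)
        · rfl
        · exact add_comm _ _
    simp_rw [key]
    by_cases hab' : a = b
    · subst hab'
      simp only [or_self, if_true]
      rw [Finset.sum_eq_single a, Finset.sum_eq_single a]
      · simp
      · intro y _ hy; simp [hy]
      · simp
      · intro x _ hx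
        exact Finset.sum_eq_zero fun y _ => by simp [hx]
      · simp
    · rw [if_neg hab']
      have : ∀ x, (∑ y, if (x = a ∧ y = b) ∨ (x = b ∧ y = a) then G x y else 0)
          = (if x = a then G a b else 0) + (if x = b then G b a else 0) := by
        intro x
        by_cases hxa : x = a
        · subst hxa
          rw [if_pos rfl, if_neg hab', add_zero, Finset.sum_eq_single b]
          · simp [hab']
          · intro y _ hy; simp [hy, hab']
          · simp
        · by_cases hxb : x = b
          · subst hxb
            rw [if_neg hxa, if_pos rfl, zero_add, Finset.sum_eq_single a]
            · simp [hxa]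
            · intro y _ hy; simp [hy, hxa]
            · simp
          · rw [if_neg hxa, if_neg hxb, add_zero]
            exact Finset.sum_eq_zero fun y _ => by simp [hxa, hxb]
      simp_rw [this]
      rw [Finset.sum_add_distrib, Finset.sum_ite_eq' Finset.univ a, Finset.sum_ite_eq' Finset.univ b]
      simp
  have hzero : ∀ a b : Fin 6, ¬ ((a = i ∧ b = i) ∨ (a = k ∧ b = l) ∨ (a = l ∧ b = k)) → G a b = 0 := by
    intro a b hab
    have h := hB (δ a + δ b)
    rw [hclass a b hab] at h
    by_cases hab' : a = b
    · rwa [if_pos hab'] at h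
    · rw [if_neg hab', hsym a b] at h
      linarith
  -- the special class `{(i,i),(k,l),(l,k)}`
  have hspec : (∑ x, ∑ y, if δ x + δ y = δ i + δ i then G x y else 0) = G i i + G k l + G l k := by
    have key : ∀ x y, (δ x + δ y = δ i + δ i) ↔ ((x = i ∧ y = i) ∨ (x = k ∧ y = l) ∨ (x = l ∧ y = k)) := by
      intro x y
      constructor
      · intro h
        rcases honly x y i i h with (⟨h1, h2⟩ | ⟨h1, h2⟩) | ⟨h2, _⟩
        · exact Or.inl ⟨h1, h2⟩
        · exact Or.inl ⟨h1, h2⟩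
        · exact h2
      · rintro (⟨rfl, rfl⟩ | ⟨rfl, rfl⟩ | ⟨rfl, rfl⟩)
        · rfl
        · linarith
        · linarith
    simp_rw [key]
    have : ∀ x, (∑ y, if (x = i ∧ y = i) ∨ (x = k ∧ y = l) ∨ (x = l ∧ y = k) then G x y else 0)
        = (if x = i then G i i else 0) + (if x = k then G k l else 0) + (if x = l then G l k else 0) := by
      intro x
      by_cases hxi : x = i
      · subst hxi
        rw [if_pos rfl, if_neg hik, if_neg hil, add_zero, add_zero, Finset.sum_eq_single x]
        · simp
        · intro y _ hy; simp [hy, hik, hil]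
        · simp
      by_cases hxk : x = k
      · subst hxk
        rw [if_neg hxi, if_pos rfl, if_neg hkl, zero_add, add_zero, Finset.sum_eq_single l]
        · simp [hxi]
        · intro y _ hy; simp [hy, hxi, hkl]
        · simp
      by_cases hxl : x = l
      · subst hxl
        rw [if_neg hxi, if_neg hxk, if_pos rfl, zero_add, zero_add, Finset.sum_eq_single k]
        · simp [hxi, hxk]
        · intro y _ hy; simp [hy, hxi, hxk]
        · simp
      · rw [if_neg hxi, if_neg hxk, if_neg hxl, add_zero, add_zero]
        exact Finset.sum_eq_zero fun y _ => by simp [hxi, hxk, hxl]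
    simp_rw [this]
    rw [Finset.sum_add_distrib, Finset.sum_add_distrib, Finset.sum_ite_eq' Finset.univ i,
      Finset.sum_ite_eq' Finset.univ k, Finset.sum_ite_eq' Finset.univ l]
    simp
  have h0 := hB (δ i + δ i)
  rw [hspec, hsym k l] at h0
  refine ⟨hzero, ?_, ?_⟩
  · linarith
  · rw [hsym k l]; linarith

end Summit.ValiantsHypothesis.ValiantsHypothesis.Theorems.LacunarySymmetroidMatrixDescartes.WallBubbling.SecondOrder
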